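import Mathlib
import Literature.Barriers.ValiantsHypothesis.MonotoneGapDecomposition
import Literature.Barriers.ValiantsHypothesis.MonotoneGapParseTrees
import Literature.Computability.AlgebraicComplexity.ArithCircuitProofs

/-!
# `DivisionGap.PerMultiplesHard` (stmt-ValiantsHypothesis-5068), line `uncharged-face-walk`:
the typed, row-support-balanced decomposition (stub `stub_typedDecomposition`)

For `n ≥ 3`, a torus-homogeneous `g ∈ ℝ≥0[x_ij]` (`n × n` variables; all monomials have row
margins `R` and column margins `C`) with all `R i ≠ 0` writes as `g = Σ_{t<s} a_t · b_t` with
`s ≤ L(g)` (`L = complexity`, fan-in-two circuit size over `ℝ≥0`) and every `a_t` torus-homogeneous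
with margins `(ρ, γ)` whose row support `k = #{i | ρ i ≠ 0}` satisfies `n < 3k ≤ 2n`.

Proof (Jerrum–Snir [JerrumSnir1982, §3] / Jukna's balanced decomposition, run with the
ROW-SUPPORT COUNT instead of the degree, plus gate typing; template
`Literature/Barriers/ValiantsHypothesis/MonotoneGapDecomposition.lean`):
* *Row support* of `p` = rows hit by a monomial of `p` = `p.vars.image Prod.fst`; its size is
  subadditive under `+`, `*`, scalars, `1` on variables, `0` on constants (`card_image_fst_vars_*`).
* *Descent* (`exists_window_gate`, for an abstract subadditive measure `μ` with `3μ(xᵢ) ≤ N`,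
  `μ(c) = 0`): below a gate value with `2N < 3μ` some gate value has `N < 3μ ≤ 2N` (a fan-in-`≤ 2`
  gate has an operand carrying half of `μ`; `3μ > N` rules out inputs, so it is an earlier gate).
  The output of a circuit for `g ≠ 0` hits all `n` rows and `3n > 2n` (`exists_balanced_gate`).
* *Peeling* (`exists_typed_list`): zero the balanced gate `v` — `P.eval = (P.zeroAt v).eval + p_v·q`
  (`exists_eval_eq_zeroAt_add`); if `q ≠ 0`, `supp p_v + supp q ⊆ supp g` types `p_v` (margins of
  `g` minus those of a fixed monomial of `q`) and `{ρ ≠ 0}` is the row support of `p_v`; the new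
  gate values are coefficientwise below the old ones and vanish at `v`, so at most `size P = L(g)`
  rounds occur.

Log (stub-worker): written from the template with the measure abstracted; row support via
`MvPolynomial.vars`; one file (no Aux split needed).
-/

noncomputable section

open MvPolynomial Literature.Computability.AlgebraicComplexity
open scoped NNReal BigOperators
open Literature.Barriers.ValiantsHypothesis
open Literature.Computability.AlgebraicComplexity.ArithCircuit

namespace Summit.ValiantsHypothesis.ValiantsHypothesis.Theorems.DivisionGap.PerMultiplesHard.TypedDecomposition

variable {k : Type*} [CommSemiring k] {σ : Type*}

/-- A fan-in-`≤ 2` sum gate whose value has measure `μ` with `2N < 3μ` has an operand of measure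
`> N/3` (`μ` subadditive, non-increasing under scalars, `μ 0 = 0`). [folklore] -/
theorem exists_operand_of_lt_sum (μ : MvPolynomial σ k → ℕ) (N : ℕ)
    (hadd : ∀ p q, μ (p + q) ≤ μ p + μ q)
    (hsmul : ∀ (c : k) (p : MvPolynomial σ k), μ (c • p) ≤ μ p) (h0 : μ 0 = 0)
    (vals : List (MvPolynomial σ k)) (args : List (k × Operand k σ))
    (hlen : args.length ≤ 2) (h : 2 * N < 3 * μ ((Gate.sum args).eval vals)) :
    ∃ a ∈ args, N < 3 * μ (a.2.eval vals) := by
  match args, hlen with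
  | [], _ => simp [Gate.eval, h0] at h
  | [a], _ =>
    refine ⟨a, by simp, ?_⟩
    simp only [Gate.eval, List.map_cons, List.map_nil, List.sum_cons, List.sum_nil, add_zero] at h
    have h₁ := hsmul a.1 (a.2.eval vals)
    omega
  | [a₁, a₂], _ =>
    simp only [Gate.eval, List.map_cons, List.map_nil, List.sum_cons, List.sum_nil, add_zero] at h
    have h' := hadd (a₁.1 • a₁.2.eval vals) (a₂.1 • a₂.2.eval vals)
    have h₁ := hsmul a₁.1 (a₁.2.eval vals)
    have h₂ := hsmul a₂.1 (a₂.2.eval vals)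
    rcases lt_or_ge N (3 * μ (a₁.2.eval vals)) with hlt | hge
    · exact ⟨a₁, by simp, hlt⟩
    · exact ⟨a₂, by simp, by omega⟩
  | _ :: _ :: _ :: _, hlen => simp at hlen

/-- A fan-in-`≤ 2` product gate whose value has measure `μ` with `2N < 3μ` has an operand of
measure `> N/3` (`μ` subadditive under products, `μ 1 = 0`). [folklore] -/
theorem exists_operand_of_lt_prod (μ : MvPolynomial σ k → ℕ) (N : ℕ)
    (hmul : ∀ p q, μ (p * q) ≤ μ p + μ q) (h1 : μ 1 = 0) (vals : List (MvPolynomial σ k))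
    (args : List (Operand k σ)) (hlen : args.length ≤ 2)
    (h : 2 * N < 3 * μ ((Gate.prod args).eval vals)) :
    ∃ u ∈ args, N < 3 * μ (u.eval vals) := by
  match args, hlen with
  | [], _ => simp [Gate.eval, h1] at h
  | [u], _ =>
    refine ⟨u, by simp, ?_⟩
    simp only [Gate.eval, List.map_cons, List.map_nil, List.prod_cons, List.prod_nil, mul_one] at h
    omega
  | [u₁, u₂], _ =>
    simp only [Gate.eval, List.map_cons, List.map_nil, List.prod_cons, List.prod_nil, mul_one] at h
    have h' := hmul (u₁.eval vals) (u₂.eval vals)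
    rcases lt_or_ge N (3 * μ (u₁.eval vals)) with hlt | hge
    · exact ⟨u₁, by simp, hlt⟩
    · exact ⟨u₂, by simp, by omega⟩
  | _ :: _ :: _ :: _, hlen => simp at hlen

/-- **Descent (abstract form).** In a fan-in-two gate list, if the value of gate `w` has measure
`μ` with `2N < 3μ`, then some gate value has measure in the window `N < 3μ ≤ 2N`; here `μ` is any
subadditive (for `+`, `*`, scalars) measure vanishing on constants with `3μ(xᵢ) ≤ N` on variables.
Jerrum–Snir's / Jukna's walk towards the inputs, run with `μ` in place of the degree.
[cite: JerrumSnir1982, §3.3 (proof of Thm. 3.4)] -/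
theorem exists_window_gate (gs : List (Gate k σ)) (h2 : ∀ g ∈ gs, g.fanIn ≤ 2)
    (μ : MvPolynomial σ k → ℕ) (N : ℕ)
    (hadd : ∀ p q, μ (p + q) ≤ μ p + μ q) (hmul : ∀ p q, μ (p * q) ≤ μ p + μ q)
    (hsmul : ∀ (c : k) (p : MvPolynomial σ k), μ (c • p) ≤ μ p)
    (hX : ∀ i, 3 * μ (X i) ≤ N) (hC : ∀ c, μ (C c) = 0)
    (w : ℕ) (hw : 2 * N < 3 * μ ((gateValues gs).getD w 0)) :
    ∃ v : ℕ, N < 3 * μ ((gateValues gs).getD v 0) ∧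
      3 * μ ((gateValues gs).getD v 0) ≤ 2 * N := by
  have h0 : μ 0 = 0 := by simpa using hC 0
  have h1 : μ 1 = 0 := by simpa using hC 1
  induction w using Nat.strong_induction_on with
  | _ w ih =>
    -- the gate at `w` exists (junk values have measure `0`)
    rcases hg : gs[w]? with _ | g
    · rw [getD_gateValues_eq_zero hg, h0] at hw; omega
    have hval := getD_gateValues hg
    set vals := (gateValues gs).take w with hvals
    -- an operand of gate `w` of measure `> N/3` leads, by induction, to the window
    have hop : ∀ u : Operand k σ, N < 3 * μ (u.eval vals) →
        ∃ v : ℕ, N < 3 * μ ((gateValues gs).getD v 0) ∧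
          3 * μ ((gateValues gs).getD v 0) ≤ 2 * N := by
      intro u hu
      cases u with
      | var i => have hi := hX i; simp only [Operand.eval] at hu; omega
      | const c => rw [show (Operand.const c).eval vals = C c from rfl, hC] at hu; omega
      | gate j =>
        simp only [Operand.eval_gate] at hu
        rw [hvals, getD_take_gateValues] at hu
        split_ifs at hu with hjw
        · by_cases hle : 3 * μ ((gateValues gs).getD j 0) ≤ 2 * N
          · exact ⟨j, hu, hle⟩
          · exact ih j hjw (by omega)
        · rw [h0] at hu; omega
    have hfan : g.fanIn ≤ 2 := h2 g (List.mem_of_getElem? hg)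
    cases g with
    | sum args =>
      rw [hval] at hw
      have hlen : args.length ≤ 2 := by simpa [Gate.fanIn, Gate.args] using hfan
      obtain ⟨a, -, ha⟩ := exists_operand_of_lt_sum μ N hadd hsmul h0 vals args hlen hw
      exact hop a.2 ha
    | prod args =>
      rw [hval] at hw
      obtain ⟨u, -, hu⟩ := exists_operand_of_lt_prod μ N hmul h1 vals args hfan hw
      exact hop u hu

/-- **Descent from an operand.** If an operand read against all gate values (e.g. the output
operand) has measure `μ` with `2N < 3μ`, some gate value lies in the window `N < 3μ ≤ 2N`.
[cite: JerrumSnir1982, §3.3 (proof of Thm. 3.4)] -/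
theorem exists_window_operand (gs : List (Gate k σ)) (h2 : ∀ g ∈ gs, g.fanIn ≤ 2)
    (μ : MvPolynomial σ k → ℕ) (N : ℕ)
    (hadd : ∀ p q, μ (p + q) ≤ μ p + μ q) (hmul : ∀ p q, μ (p * q) ≤ μ p + μ q)
    (hsmul : ∀ (c : k) (p : MvPolynomial σ k), μ (c • p) ≤ μ p)
    (hX : ∀ i, 3 * μ (X i) ≤ N) (hC : ∀ c, μ (C c) = 0)
    (u : Operand k σ) (hu : 2 * N < 3 * μ (u.eval (gateValues gs))) :
    ∃ v : ℕ, N < 3 * μ ((gateValues gs).getD v 0) ∧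
      3 * μ ((gateValues gs).getD v 0) ≤ 2 * N := by
  cases u with
  | var i => have hi := hX i; simp only [Operand.eval] at hu; omega
  | const c => rw [show (Operand.const c).eval (gateValues gs) = C c from rfl, hC] at hu; omega
  | gate j =>
    simp only [Operand.eval_gate] at hu
    by_cases hle : 3 * μ ((gateValues gs).getD j 0) ≤ 2 * N
    · exact ⟨j, by omega, hle⟩
    · exact exists_window_gate gs h2 μ N hadd hmul hsmul hX hC j (by omega)

section RowSupport

variable {α β : Type*} [DecidableEq α] [DecidableEq β]

/-- Row support of a sum: `rows(p + q) ⊆ rows p ∪ rows q`, counted. [folklore] -/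
theorem card_image_fst_vars_add_le (p q : MvPolynomial (α × β) k) :
    ((p + q).vars.image Prod.fst).card ≤
      (p.vars.image Prod.fst).card + (q.vars.image Prod.fst).card := by
  calc ((p + q).vars.image Prod.fst).card ≤ ((p.vars ∪ q.vars).image Prod.fst).card :=
        Finset.card_le_card (Finset.image_subset_image (vars_add_subset p q))
    _ ≤ _ := by rw [Finset.image_union]; exact Finset.card_union_le _ _

/-- Row support of a product: `rows(p * q) ⊆ rows p ∪ rows q`, counted. [folklore] -/
theorem card_image_fst_vars_mul_le (p q : MvPolynomial (α × β) k) :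
    ((p * q).vars.image Prod.fst).card ≤
      (p.vars.image Prod.fst).card + (q.vars.image Prod.fst).card := by
  calc ((p * q).vars.image Prod.fst).card ≤ ((p.vars ∪ q.vars).image Prod.fst).card :=
        Finset.card_le_card (Finset.image_subset_image (vars_mul p q))
    _ ≤ _ := by rw [Finset.image_union]; exact Finset.card_union_le _ _

/-- Row support of a scalar multiple: `rows(c • p) ⊆ rows p`, counted. [folklore] -/
theorem card_image_fst_vars_smul_le (c : k) (p : MvPolynomial (α × β) k) :
    ((c • p).vars.image Prod.fst).card ≤ (p.vars.image Prod.fst).card := by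
  refine Finset.card_le_card (Finset.image_subset_image ?_)
  rw [smul_eq_C_mul]
  refine (vars_mul _ _).trans ?_
  rw [vars_C, Finset.empty_union]

omit [DecidableEq β] in
/-- A variable `x_{ij}` has row support `{i}`. [folklore] -/
theorem card_image_fst_vars_X [Nontrivial k] (e : α × β) :
    ((X e : MvPolynomial (α × β) k).vars.image Prod.fst).card = 1 := by
  rw [vars_X, Finset.image_singleton, Finset.card_singleton]

omit [DecidableEq β] in
/-- A constant has empty row support. [folklore] -/
theorem card_image_fst_vars_C (c : k) :
    ((C c : MvPolynomial (α × β) k).vars.image Prod.fst).card = 0 := by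
  rw [vars_C, Finset.image_empty, Finset.card_empty]

end RowSupport

variable {n : ℕ}

/-- If every monomial of `g ≠ 0` has the row margins `R`, all positive, then every row is hit:
the row support of `g` is everything. [folklore] -/
theorem image_fst_vars_eq_univ {g : MvPolynomial (Fin n × Fin n) ℝ≥0} {R : Fin n → ℕ}
    (hg : ∀ m ∈ g.support, ∀ i, ∑ j, m (i, j) = R i) (hR : ∀ i, R i ≠ 0) (h0 : g ≠ 0) :
    g.vars.image Prod.fst = Finset.univ := by
  obtain ⟨m, hm⟩ := support_nonempty.mpr h0
  refine Finset.eq_univ_of_forall fun i => ?_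
  have hi : ∑ j, m (i, j) ≠ 0 := by rw [hg m hm i]; exact hR i
  obtain ⟨j, -, hj⟩ := Finset.exists_ne_zero_of_sum_ne_zero hi
  exact Finset.mem_image.mpr
    ⟨(i, j), (mem_vars_iff_mem_support _).mpr ⟨m, hm, Finsupp.mem_support_iff.mpr hj⟩, rfl⟩

/-- For a typed `p ≠ 0` (all monomials have the row margins `ρ`) the rows with nonzero margin
are exactly the row support of `p`. [folklore] -/
theorem filter_ne_zero_eq_image_fst_vars {p : MvPolynomial (Fin n × Fin n) ℝ≥0} {ρ : Fin n → ℕ}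
    (hp : ∀ m ∈ p.support, ∀ i, ∑ j, m (i, j) = ρ i) (h0 : p ≠ 0) :
    (Finset.univ.filter fun i => ρ i ≠ 0) = p.vars.image Prod.fst := by
  obtain ⟨m₀, hm₀⟩ := support_nonempty.mpr h0
  ext i
  simp only [Finset.mem_filter, Finset.mem_univ, true_and, Finset.mem_image,
    mem_vars_iff_mem_support, Prod.exists]
  constructor
  · intro hi
    rw [← hp m₀ hm₀ i] at hi
    obtain ⟨j, -, hj⟩ := Finset.exists_ne_zero_of_sum_ne_zero hi
    exact ⟨i, j, ⟨m₀, hm₀, Finsupp.mem_support_iff.mpr hj⟩, rfl⟩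
  · rintro ⟨i', j, ⟨m, hm, he⟩, hii'⟩
    subst hii'
    rw [← hp m hm i']
    intro hsum
    exact (Finsupp.mem_support_iff.mp he) (Finset.sum_eq_zero_iff.mp hsum j (Finset.mem_univ _))

/-- Gate typing: if `supp (p * q) ⊆ supp g` with `q ≠ 0` and every monomial of `g` has margins
`(R, C)`, then every monomial of `p` has the margins of `g` minus those of one fixed monomial of `q`
(no cancellation over `ℝ≥0`: `supp (p * q) = supp p + supp q`).
[cite: JerrumSnir1982, §3.1 (Lemma 3.1(iii))] -/
theorem exists_margins_of_support_mul_subset {g p q : MvPolynomial (Fin n × Fin n) ℝ≥0}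
    {R C' : Fin n → ℕ}
    (hg : ∀ m ∈ g.support, (∀ i, ∑ j, m (i, j) = R i) ∧ (∀ j, ∑ i, m (i, j) = C' j))
    (hpq : (p * q).support ⊆ g.support) (hq : q ≠ 0) :
    ∃ ρ γ : Fin n → ℕ,
      ∀ m ∈ p.support, (∀ i, ∑ j, m (i, j) = ρ i) ∧ (∀ j, ∑ i, m (i, j) = γ j) := by
  obtain ⟨b, hb⟩ := support_nonempty.mpr hq
  refine ⟨fun i => R i - ∑ j, b (i, j), fun j => C' j - ∑ i, b (i, j), fun m hm => ?_⟩
  have hmb : m + b ∈ g.support :=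
    hpq (by rw [JerrumSnir.support_mul_eq]; exact Finset.add_mem_add hm hb)
  obtain ⟨hr, hc⟩ := hg _ hmb
  refine ⟨fun i => ?_, fun j => ?_⟩
  · have h := hr i
    simp only [Finsupp.coe_add, Pi.add_apply, Finset.sum_add_distrib] at h
    show ∑ j, m (i, j) = R i - ∑ j, b (i, j)
    omega
  · have h := hc j
    simp only [Finsupp.coe_add, Pi.add_apply, Finset.sum_add_distrib] at h
    show ∑ i, m (i, j) = C' j - ∑ i, b (i, j)
    omega

/-- The zeroed gate has value `0` (in range: the empty sum; out of range: junk `0`). [folklore] -/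
theorem getD_gateValues_set_zeroGate (gs : List (Gate k σ)) (v : ℕ) :
    (gateValues (gs.set v zeroGate)).getD v 0 = 0 := by
  rcases lt_or_ge v gs.length with hv | hv
  · have h : (gs.set v zeroGate)[v]? = some zeroGate := List.getElem?_set_self hv
    rw [getD_gateValues h]
    simp [zeroGate, Gate.eval]
  · rw [List.set_eq_of_length_le hv]
    exact getD_gateValues_eq_zero (List.getElem?_eq_none_iff.mpr hv)

/-- No cancellation over `ℝ≥0`: `0 = a + b` forces `a = 0`. [cite: JerrumSnir1982, §2.2] -/
theorem eq_zero_of_zero_eq_add {a b : MvPolynomial σ ℝ≥0} (h : (0 : MvPolynomial σ ℝ≥0) = a + b) :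
    a = 0 := by
  have hs := support_subset_of_eq_add h
  rwa [support_zero, Finset.subset_empty, support_eq_empty] at hs

/-- **A balanced gate.** If a fan-in-two circuit over `ℝ≥0` computes a nonzero polynomial in the
`n × n` variables (`n ≥ 3`) all of whose monomials have the positive row margins `R`, then some
gate value `p` has row support `rows p` of size `k` with `n < 3k ≤ 2n`: the output hits all `n`
rows (`3n > 2n`) and the descent applies to the row-support count.
[cite: JerrumSnir1982, §3.3 (proof of Thm. 3.4)] -/
theorem exists_balanced_gate (n : ℕ) (hn : 3 ≤ n) (R : Fin n → ℕ) (hR : ∀ i, R i ≠ 0)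
    (P : ArithCircuit ℝ≥0 (Fin n × Fin n)) (h2 : P.IsFanInTwo)
    (hg : ∀ m ∈ P.eval.support, ∀ i, ∑ j, m (i, j) = R i) (h0 : P.eval ≠ 0) :
    ∃ v : ℕ, n < 3 * (((gateValues P.gates).getD v 0).vars.image Prod.fst).card ∧
      3 * (((gateValues P.gates).getD v 0).vars.image Prod.fst).card ≤ 2 * n := by
  have huniv := image_fst_vars_eq_univ hg hR h0
  have hout : 2 * n < 3 * (P.eval.vars.image Prod.fst).card := by
    rw [huniv, Finset.card_univ, Fintype.card_fin]; omega
  exact exists_window_operand P.gates h2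
    (fun p : MvPolynomial (Fin n × Fin n) ℝ≥0 => (p.vars.image Prod.fst).card) n
    card_image_fst_vars_add_le card_image_fst_vars_mul_le card_image_fst_vars_smul_le
    (fun e => by rw [card_image_fst_vars_X]; omega) card_image_fst_vars_C P.output hout

/-- **The peeling induction.** A fan-in-two circuit over `ℝ≥0` whose gate values vanish outside a
set `Z` of at most `N` indices and whose output is typed with margins `(R, C)`, all `R i > 0`,
writes its output as a sum of at most `N` products `a · b`, every `a` typed with balanced row
support: zero a balanced gate `v` (`exists_eval_eq_zeroAt_add`), type `p_v` through
`supp (p_v · q) ⊆ supp P.eval` when `q ≠ 0`, and recurse on `P.zeroAt v` (values coefficientwise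
below those of `P`, zero at `v`). [cite: JerrumSnir1982, §3 (Lemma 3.1(iii), Thm. 3.2)] -/
theorem exists_typed_list (n : ℕ) (hn : 3 ≤ n) (R C : Fin n → ℕ) (hR : ∀ i, R i ≠ 0) :
    ∀ (N : ℕ) (P : ArithCircuit ℝ≥0 (Fin n × Fin n)), P.IsFanInTwo →
      (∃ Z : Finset ℕ, Z.card ≤ N ∧ ∀ j ∉ Z, (gateValues P.gates).getD j 0 = 0) →
      (∀ m ∈ P.eval.support, (∀ i, ∑ j, m (i, j) = R i) ∧ (∀ j, ∑ i, m (i, j) = C j)) →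
      ∃ L : List (MvPolynomial (Fin n × Fin n) ℝ≥0 × MvPolynomial (Fin n × Fin n) ℝ≥0),
        L.length ≤ N ∧ P.eval = (L.map fun ab => ab.1 * ab.2).sum ∧
        ∀ ab ∈ L, ∃ ρ γ : Fin n → ℕ,
          (∀ m ∈ ab.1.support, (∀ i, ∑ j, m (i, j) = ρ i) ∧ (∀ j, ∑ i, m (i, j) = γ j)) ∧
          n < 3 * (Finset.univ.filter fun i => ρ i ≠ 0).card ∧
          3 * (Finset.univ.filter fun i => ρ i ≠ 0).card ≤ 2 * n := by
  intro N
  induction N with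
  | zero =>
    rintro P h2 ⟨Z, hZc, hZ0⟩ hg
    by_cases h0 : P.eval = 0
    · exact ⟨[], le_rfl, by simp [h0], by simp⟩
    · exfalso
      obtain ⟨v, hlo, -⟩ := exists_balanced_gate n hn R hR P h2 (fun m hm => (hg m hm).1) h0
      have hv : (gateValues P.gates).getD v 0 = 0 :=
        hZ0 v (by simp [Finset.card_eq_zero.mp (Nat.le_zero.mp hZc)])
      rw [hv, vars_0, Finset.image_empty, Finset.card_empty] at hlo
      omega
  | succ N ih =>
    rintro P h2 ⟨Z, hZc, hZ0⟩ hg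
    by_cases h0 : P.eval = 0
    · exact ⟨[], by simp, by simp [h0], by simp⟩
    obtain ⟨v, hlo, hhi⟩ := exists_balanced_gate n hn R hR P h2 (fun m hm => (hg m hm).1) h0
    obtain ⟨q, hq⟩ := exists_eval_eq_zeroAt_add P v
    have hlink := linked_gateValues_set P.gates v
    set p := (gateValues P.gates).getD v 0
    have hp0 : p ≠ 0 := by
      intro h
      rw [h, vars_0, Finset.image_empty, Finset.card_empty] at hlo
      omega
    have hvZ : v ∈ Z := by_contra fun h => hp0 (hZ0 v h)
    -- the zeroed circuit: values vanish outside `Z.erase v`, output still typed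
    have hZ' : ∃ Z' : Finset ℕ, Z'.card ≤ N ∧
        ∀ j ∉ Z', (gateValues (P.zeroAt v).gates).getD j 0 = 0 := by
      refine ⟨Z.erase v, ?_, fun j hj => ?_⟩
      · rw [Finset.card_erase_of_mem hvZ]; omega
      · by_cases hjv : j = v
        · subst hjv; exact getD_gateValues_set_zeroGate P.gates j
        · have hjZ : j ∉ Z := fun h => hj (Finset.mem_erase.mpr ⟨hjv, h⟩)
          obtain ⟨h, hh⟩ := hlink.2 j
          rw [hZ0 j hjZ] at hh
          exact eq_zero_of_zero_eq_add hh
    have hg' : ∀ m ∈ (P.zeroAt v).eval.support,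
        (∀ i, ∑ j, m (i, j) = R i) ∧ (∀ j, ∑ i, m (i, j) = C j) :=
      fun m hm => hg m (support_subset_of_eq_add hq hm)
    obtain ⟨L, hLlen, hLsum, hLtyp⟩ := ih (P.zeroAt v) (h2.zeroAt v) hZ' hg'
    by_cases hq0 : q = 0
    · refine ⟨L, by omega, ?_, hLtyp⟩
      rw [hq, hq0, mul_zero, add_zero, hLsum]
    · have hsub : (p * q).support ⊆ P.eval.support :=
        support_subset_of_eq_add (hq.trans (add_comm _ _))
      obtain ⟨ρ, γ, hty⟩ := exists_margins_of_support_mul_subset hg hsub hq0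
      refine ⟨(p, q) :: L, by simpa using hLlen, ?_, ?_⟩
      · simp only [List.map_cons, List.sum_cons]
        rw [hq, hLsum, add_comm]
      · intro ab hab
        rcases List.mem_cons.mp hab with rfl | hab
        · refine ⟨ρ, γ, hty, ?_⟩
          rw [filter_ne_zero_eq_image_fst_vars (fun m hm => (hty m hm).1) hp0]
          exact ⟨hlo, hhi⟩
        · exact hLtyp ab hab

/-- **The typed, row-support-balanced decomposition** (stub `stub_typedDecomposition`). For
`n ≥ 3`, a torus-homogeneous `g` over `ℝ≥0` (all monomials have margins `(R, C)`) with all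
`R i ≠ 0` writes as `g = Σ_{t < s} a_t · b_t` with `s ≤ L(g)` and every `a_t` torus-homogeneous with
margins `(ρ, γ)`, `n < 3 · #{i | ρ i ≠ 0} ≤ 2n`: peel (`exists_typed_list`) a minimal fan-in-two
circuit for `g` (`exists_computes_size_eq_complexity`) at most `size = L(g)` times.
[cite: JerrumSnir1982, §3 (Lemma 3.1(iii), Thm. 3.2, proof of Thm. 3.4)] -/
theorem stub_typedDecomposition (n : ℕ) (hn : 3 ≤ n) (g : MvPolynomial (Fin n × Fin n) ℝ≥0)
    (R C : Fin n → ℕ)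
    (hg : ∀ m ∈ g.support, (∀ i, ∑ j, m (i, j) = R i) ∧ (∀ j, ∑ i, m (i, j) = C j))
    (hR : ∀ i, R i ≠ 0) :
    ∃ s : ℕ, s ≤ complexity g ∧
      ∃ a b : Fin s → MvPolynomial (Fin n × Fin n) ℝ≥0,
        g = ∑ t, a t * b t ∧
        ∀ t, ∃ ρ γ : Fin n → ℕ,
          (∀ m ∈ (a t).support, (∀ i, ∑ j, m (i, j) = ρ i) ∧ (∀ j, ∑ i, m (i, j) = γ j)) ∧
          n < 3 * (Finset.univ.filter fun i => ρ i ≠ 0).card ∧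
          3 * (Finset.univ.filter fun i => ρ i ≠ 0).card ≤ 2 * n := by
  obtain ⟨P, h2, hPg, hsize⟩ := exists_computes_size_eq_complexity g
  have heval : P.eval = g := hPg
  subst heval
  have hZ : ∃ Z : Finset ℕ, Z.card ≤ P.size ∧ ∀ j ∉ Z, (gateValues P.gates).getD j 0 = 0 := by
    refine ⟨Finset.range P.size, by simp, fun j hj => getD_gateValues_eq_zero ?_⟩
    exact List.getElem?_eq_none_iff.mpr (by simpa [ArithCircuit.size] using hj)
  obtain ⟨L, hLlen, hLsum, hLtyp⟩ := exists_typed_list n hn R C hR P.size P h2 hZ hg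
  refine ⟨L.length, hsize ▸ hLlen, fun t => (L[t.1]).1, fun t => (L[t.1]).2, ?_,
    fun t => hLtyp _ (List.getElem_mem _)⟩
  rw [Fin.sum_univ_fun_getElem L (fun ab => ab.1 * ab.2)]
  exact hLsum

end Summit.ValiantsHypothesis.ValiantsHypothesis.Theorems.DivisionGap.PerMultiplesHard.TypedDecomposition
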